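import Summits.SmoothPoincare4.SmoothPoincare4.Theses.WeakReductionDescent

/-!
# Sketch (crux-strategist s1, stmt-SmoothPoincare4-17907): the census signatures that are NOT filed

* `UnstabilisedDichotomy` — S⁺ of STRATEGY-CENSUS §Strengthen (S1): K1 with GLOBAL minimality replaced by the
  local disjunct "or T has a destabilising pair" (MSZ16 Prop 3.9).  Expected FALSE on S⁴ (AZ25 Q8.3 / MSZ16
  Conj 3.11), hence not filed; typed here to show the census entry is a statement, not a gesture.
* `DestabilisationLowersGenus` — its theorem-shaped companion.
* `unstabilisedDichotomy_glue` — S⁺ ∧ companion ⇒ K1, pure logic (the rejected decomposition D3).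
* `MinimalWeaklyReducibleIH` — finding S4: K1 weakened by the induction hypothesis that `closes` has in
  scope; `minimalWeaklyReducibleIH_of` shows K1 ⇒ K1^IH (so the restatement is a pure weakening).
-/

noncomputable section

set_option linter.dupNamespace false

open scoped Manifold ContDiff Topology ContinuousMap
open Set
open Summit.SmoothPoincare4.SmoothPoincare4.Theses.WeakReductionDescent

namespace Summit.SmoothPoincare4.SmoothPoincare4.Cruxes.MinimalWeaklyReducible.StrategistSketch

/-- Local notation: the round `4`-sphere. -/
local notation "𝕊⁴" => (Metric.sphere (0 : EuclideanSpace ℝ (Fin 5)) 1)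

/-- The crux's `let`-clauses, factored once (verbatim). -/
def F {M : Type} (T : Fin 3 → Set M) : Set M := ⋂ l, T l
/-- Handlebody opposite `p`. -/
def H {M : Type} (T : Fin 3 → Set M) (p : Fin 3) : Set M := ⋂ (l : Fin 3) (_ : l ≠ p), T l
/-- A curve on the central surface. -/
def IsCurve {M : Type} [TopologicalSpace M] [ChartedSpace (EuclideanSpace ℝ (Fin 4)) M]
    (T : Fin 3 → Set M) (c : Set M) : Prop :=
  c ⊆ F T ∧ ∃ γ : (Metric.sphere (0 : EuclideanSpace ℝ (Fin 2)) 1) → M,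
    Manifold.IsSmoothEmbedding (𝓡 1) (𝓡 4) ((⊤ : ℕ∞) : WithTop ℕ∞) γ ∧ Set.range γ = c
/-- `c` bounds a properly embedded disc in `A`. -/
def BoundsDisc {M : Type} [TopologicalSpace M] [ChartedSpace (EuclideanSpace ℝ (Fin 4)) M]
    (T : Fin 3 → Set M) (A c : Set M) : Prop :=
  ∃ d : (Metric.closedBall (0 : EuclideanSpace ℝ (Fin 2)) 1) → M,
    Manifold.IsSmoothEmbedding (𝓡∂ 2) (𝓡 4) ((⊤ : ℕ∞) : WithTop ℕ∞) d ∧ Set.range d ⊆ A ∧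
    d '' ((𝓡∂ 2).boundary (Metric.closedBall (0 : EuclideanSpace ℝ (Fin 2)) 1)) = c ∧ Set.range d ∩ F T = c
/-- Non-separating. -/
def NonSep {M : Type} [TopologicalSpace M] (T : Fin 3 → Set M) (c : Set M) : Prop := IsConnected (F T \ c)
/-- Weakly reducible (the crux's conclusion, verbatim up to the factoring). -/
def WR {M : Type} [TopologicalSpace M] [ChartedSpace (EuclideanSpace ℝ (Fin 4)) M] (T : Fin 3 → Set M) : Prop :=
  ∃ (p : Fin 3) (c c' : Set M), IsCurve T c ∧ IsCurve T c' ∧ Disjoint c c' ∧ NonSep T c ∧ NonSep T c' ∧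
    BoundsDisc T (H T p) c ∧ ∀ q : Fin 3, q ≠ p → BoundsDisc T (H T q) c'

/-- **Destabilising pair** (MSZ16 Prop 3.9, typed with transversality): a curve `c` compressing in `H p` and a
`(q,r)`-core `d` (compressing in both other handlebodies, non-separating) given by smooth embeddings `γ`, `δ`
meeting in EXACTLY ONE point, transversally (the two velocity lines span a plane). -/
def HasDestabilisingPair {M : Type} [TopologicalSpace M] [ChartedSpace (EuclideanSpace ℝ (Fin 4)) M]
    (T : Fin 3 → Set M) : Prop :=
  ∃ (p : Fin 3) (γ δ : (Metric.sphere (0 : EuclideanSpace ℝ (Fin 2)) 1) → M),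
    Manifold.IsSmoothEmbedding (𝓡 1) (𝓡 4) ((⊤ : ℕ∞) : WithTop ℕ∞) γ ∧
    Manifold.IsSmoothEmbedding (𝓡 1) (𝓡 4) ((⊤ : ℕ∞) : WithTop ℕ∞) δ ∧
    Set.range γ ⊆ F T ∧ Set.range δ ⊆ F T ∧ NonSep T (Set.range δ) ∧
    BoundsDisc T (H T p) (Set.range γ) ∧ (∀ q : Fin 3, q ≠ p → BoundsDisc T (H T q) (Set.range δ)) ∧
    ∃ (s t : (Metric.sphere (0 : EuclideanSpace ℝ (Fin 2)) 1)), γ s = δ t ∧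
      Set.range γ ∩ Set.range δ = {γ s} ∧
      Module.finrank ℝ ↥(LinearMap.range (mfderiv (𝓡 1) (𝓡 4) γ s).toLinearMap ⊔
        LinearMap.range (mfderiv (𝓡 1) (𝓡 4) δ t).toLinearMap) = 2

/-- **S⁺ = `UnstabilisedDichotomy`** (census §Strengthen S1; NOT filed — expected false on `S⁴`): every GK-trisection
of genus `g ≥ 3` of a smooth homotopy 4-sphere is weakly reducible OR has a destabilising pair. -/
def UnstabilisedDichotomy : Prop :=
  ∀ (M : Type) [TopologicalSpace M] [T2Space M] [SecondCountableTopology M]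
    [ChartedSpace (EuclideanSpace ℝ (Fin 4)) M] [IsManifold (𝓡 4) ((⊤ : ℕ∞) : WithTop ℕ∞) M],
    (M ≃ₕ 𝕊⁴) → ∀ (g : ℕ) (k : Fin 3 → ℕ) (T : Fin 3 → Set M),
      Literature.Topology.FourManifolds.IsGKTrisection M g k T → 3 ≤ g → (WR T ∨ HasDestabilisingPair T)

/-- **Companion** (theorem-shaped, MSZ16 Prop 3.9 ⇒): a destabilising pair exhibits a GK-trisection of genus `g − 1`. -/
def DestabilisationLowersGenus : Prop :=
  ∀ (M : Type) [TopologicalSpace M] [T2Space M] [SecondCountableTopology M]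
    [ChartedSpace (EuclideanSpace ℝ (Fin 4)) M] [IsManifold (𝓡 4) ((⊤ : ℕ∞) : WithTop ℕ∞) M],
    ∀ (g : ℕ) (k : Fin 3 → ℕ) (T : Fin 3 → Set M),
      Literature.Topology.FourManifolds.IsGKTrisection M g k T → HasDestabilisingPair T →
        ∃ (g' : ℕ) (k' : Fin 3 → ℕ) (T' : Fin 3 → Set M),
          Literature.Topology.FourManifolds.IsGKTrisection M g' k' T' ∧ g' + 1 = g

/-- The crux, read through the factoring (`Iff.rfl`). -/
theorem minimalWeaklyReducible_iff :
    MinimalWeaklyReducible ↔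
      ∀ (M : Type) [TopologicalSpace M] [T2Space M] [SecondCountableTopology M]
        [ChartedSpace (EuclideanSpace ℝ (Fin 4)) M] [IsManifold (𝓡 4) ((⊤ : ℕ∞) : WithTop ℕ∞) M],
        (M ≃ₕ 𝕊⁴) → ∀ (g : ℕ) (k : Fin 3 → ℕ) (T : Fin 3 → Set M),
          Literature.Topology.FourManifolds.IsGKTrisection M g k T → 3 ≤ g →
          (∀ (g' : ℕ) (k' : Fin 3 → ℕ) (T' : Fin 3 → Set M),
            Literature.Topology.FourManifolds.IsGKTrisection M g' k' T' → g ≤ g') → WR T :=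
  Iff.rfl

/-- **Rejected decomposition D3**: S⁺ ∧ companion ⇒ K1, by pure logic (minimality excludes the second disjunct). -/
theorem unstabilisedDichotomy_glue (h₁ : UnstabilisedDichotomy) (h₂ : DestabilisationLowersGenus) :
    MinimalWeaklyReducible := by
  rw [minimalWeaklyReducible_iff]
  intro M _ _ _ _ _ e g k T hT hg hmin
  rcases h₁ M e g k T hT hg with hwr | hstab
  · exact hwr
  · obtain ⟨g', k', T', hT', hg'⟩ := h₂ M g k T hT hstab
    have := hmin g' k' T' hT'
    omega

/-- **Finding S4 — `MinimalWeaklyReducibleIH`**: K1 weakened by the induction hypothesis that the route's `closes` has in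
scope at the call site ("every homotopy 4-sphere with a GK-trisection of smaller genus is diffeomorphic to `S⁴`"). -/
def MinimalWeaklyReducibleIH : Prop :=
  ∀ (g : ℕ), (∀ (M' : Type) [TopologicalSpace M'] [T2Space M'] [SecondCountableTopology M']
      [ChartedSpace (EuclideanSpace ℝ (Fin 4)) M'] [IsManifold (𝓡 4) ((⊤ : ℕ∞) : WithTop ℕ∞) M'],
      (M' ≃ₕ 𝕊⁴) → ∀ (g' : ℕ) (k' : Fin 3 → ℕ) (T' : Fin 3 → Set M'),
        Literature.Topology.FourManifolds.IsGKTrisection M' g' k' T' → g' < g →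
        Nonempty (Diffeomorph (𝓡 4) (𝓡 4) M' 𝕊⁴ ((⊤ : ℕ∞) : WithTop ℕ∞))) →
    ∀ (M : Type) [TopologicalSpace M] [T2Space M] [SecondCountableTopology M]
      [ChartedSpace (EuclideanSpace ℝ (Fin 4)) M] [IsManifold (𝓡 4) ((⊤ : ℕ∞) : WithTop ℕ∞) M],
      (M ≃ₕ 𝕊⁴) → ∀ (k : Fin 3 → ℕ) (T : Fin 3 → Set M),
        Literature.Topology.FourManifolds.IsGKTrisection M g k T → 3 ≤ g →
        (∀ (g' : ℕ) (k' : Fin 3 → ℕ) (T' : Fin 3 → Set M),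
          Literature.Topology.FourManifolds.IsGKTrisection M g' k' T' → g ≤ g') → WR T

/-- K1 ⇒ K1^IH (the restatement is a pure weakening; `closes` would call it with its `IH`). -/
theorem minimalWeaklyReducibleIH_of (h : MinimalWeaklyReducible) : MinimalWeaklyReducibleIH := by
  intro g _IH M _ _ _ _ _ e k T hT hg hmin
  exact (minimalWeaklyReducible_iff.1 h) M e g k T hT hg hmin

end Summit.SmoothPoincare4.SmoothPoincare4.Cruxes.MinimalWeaklyReducible.StrategistSketch

end
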